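import Summits.Ventures.LatticeQCDFlow.Scaling.ConveyorLegs
import Literature.NumberTheory.Sieve.MatomakiRadziwillLemma14

/-!
HONEST FRAMING: exact (Metropolis-corrected) sampling algorithms for lattice gauge theory; figures
of merit are autocorrelation/cost numbers at stated couplings and volumes; no continuum-physics
claim.

# ConveyorPoincare — A POINCARÉ INEQUALITY FOR A CHAIN ON MODE ASSIGNMENTS `Fin (K+1) → J` WHOSE ONLY ASSUMED
# EDGES ARE ADJACENT TRANSPOSITIONS AND RELABELLING AT THE HOT LEVEL: `C·Var_{ν⊗}(f) ≤ 𝓔_{ν⊗}(Q; f)` FOR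
# `C·6K(K+1) ≤ p D κ` AND `C·6(K+1) ≤ p D ρθ` (`D` THE DISPLACEMENT FACTOR, `= q^K` UNDER ONE-LEVEL COOLING)
# (lean-2 GEN-18, ours)

Venture-side (OURS).  Cell `lqcd-flow` (pub-lqcd), unit `pub-lqcd-lean-2-g18`, 2026-08-25.  The replica-exchange
counterpart of `Scaling/SpiderPoincare` (GEN-17).  Along the "modes as blocks" decomposition of a replica-exchange
(parallel-tempering) sampler with `K+1` levels and modes `J`, the projection chain lives on MODE ASSIGNMENTS
`z : Fin (K+1) → J`; its law is the product `ν⊗ = tensorFun ν` of the mode masses `ν_k` of the levels; an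
accepted swap of the replicas at levels `l, l+1` TRANSPOSES two labels (`z ↦ z ∘ swap(l,l+1)`), and a replica
update at the hot level `0` that crosses modes RELABELS position `0` (`z ↦ update z 0 v`).  This file bounds the
Poincaré constant of ANY chain `Q ≥ 0` on `Fin (K+1) → J` from these two families of edges:

* transposition conductance `κ > 0`: `ν⊗(z)Q(z, z∘σ_l) ≥ κ·min{ν⊗(z), ν⊗(z∘σ_l)}` for every `z`, `l`;
* a hot comparison chain: a `ν_0`-chain `Q₀` on `J` with `ρ·Var_{ν_0}(h) ≤ 𝓔_{ν_0}(Q₀; h)` whose moves are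
  dominated at the hot position, `θ·ν⊗(z)Q₀(z_0, v) ≤ ν⊗(z)Q(z, update z 0 v)` (`v ≠ z_0`);
* persistence of the mode masses `p·ν_k(j) ≤ ν_i(j)` for `i ≤ k` (heating keeps the fraction `p`) and a
  displacement factor `D`: `D·Π_j ν_{k.succAbove j}(r_j) ≤ Π_j ν_{i.succAbove j}(r_j)` for `i ≤ k` — e.g. `D = q^K`
  when cooling by ONE level keeps the fraction `q` (`Scaling/ConveyorLegs.displacement_of_cooling`); the corollary
  `conveyor_poincare_of_cooling` is stated in that form.

## What is proved

**`conveyor_poincare`** — Efron–Stein (`Scaling/ConveyorLadder.efronStein_tensorFun`: `Var ≤ Σ_k` one-coordinate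
variances), the three-leg split `z → U_k z → (U_k z)⁰ᵛ → z^{k→v}` (`U_k z` = the label of level `k` bubbled to
level `0`), the two legs of `Scaling/ConveyorLegs` (arm `≤ (k/(p q^K κ))·`transposition terms, source
`≤ (2/(p q^K ρθ))·`relabel terms) and the kept flows give **`C·Var_{ν⊗}(f) ≤ 𝓔_{ν⊗}(Q; f)` for every `C ≥ 0` with
`C·6K(K+1) ≤ p q^K κ` and `C·6(K+1) ≤ p q^K ρθ`**: the Poincaré constant is at least
`(p q^K/(6(K+1)))·min{κ/K, ρθ}` — compare the spider's `(p/(K+1))·min{κ/K, ρθ/2}` for simulated tempering.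

Reading (no numerics implied): for replica exchange the price of refreshing a cold replica's mode is a conveyor ride
of length `≤ K` to the hottest level and back; persistence enters once for the travelling label (`p`) and once for
the labels it displaces (`D`, e.g. `q^K`).  NOT CLAIMED: sharp constants; the one-sided-persistence displacement
factor (`D = p^{#modes}` under monotone mode masses, Woodard–Schmidler–Huber's form) — it plugs into `hD`;
anything about a specific sampler (chapter R instantiates).  Literature grade (cell rule): KNOWN MECHANISM
(comparison / canonical paths for interchange processes, Diaconis–Saloff-Coste, Ann. Appl. Probab. 3 (1993) 696–730;
decomposition conditions for swapping chains, Woodard–Schmidler–Huber, Ann. Appl. Probab. 19 (2009) 617–640;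
Madras–Zheng, Random Structures Algorithms 22 (2003) 66–97), NEW TYPING (explicit constants, general hot chain);
nothing cited as a fact; no new bib keys.
-/

noncomputable section

open Finset Function
open Literature.Probability.MarkovChains

namespace Summit.Ventures.LatticeQCDFlow.Scaling

section Conveyor

variable {J : Type*} [Fintype J] [DecidableEq J] {K : ℕ} {ν : Fin (K + 1) → J → ℝ}
  {Q : Matrix (Fin (K + 1) → J) (Fin (K + 1) → J) ℝ}

/-! ## The Poincaré inequality -/

/-- **THE CONVEYOR POINCARÉ INEQUALITY.**  Let `Q ≥ 0` be a chain on `Fin (K+1) → J` and `ν_k ≥ 0` probability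
vectors with: transposition flows `ν⊗(z)Q(z, z∘σ_l) ≥ κ·min{ν⊗(z), ν⊗(z∘σ_l)}`; a `ν_0`-chain `Q₀` with
`ρ·Var_{ν_0} ≤ 𝓔_{ν_0}(Q₀)` dominated at the hot position, `θ·ν⊗(z)Q₀(z_0,v) ≤ ν⊗(z)Q(z, update z 0 v)` (`v ≠ z_0`);
persistence `p·ν_k(j) ≤ ν_i(j)` (`i ≤ k`) and a displacement factor `D > 0` (`D·Π_jν_{k.succAbove j}(r_j) ≤
Π_jν_{i.succAbove j}(r_j)`, `i ≤ k`).  Then **`C·Var_{ν⊗}(f) ≤ 𝓔_{ν⊗}(Q; f)` for every `f` and every `C ≥ 0` with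
`C·6K(K+1) ≤ p D κ` and `C·6(K+1) ≤ p D ρθ`** — the Poincaré constant is at least `(p D/(6(K+1)))·min{κ/K, ρθ}`.
[ours] -/
theorem conveyor_poincare (hν0 : ∀ k j, 0 ≤ ν k j) (hν1 : ∀ k, ∑ j, ν k j = 1) {p D κ ρ θ : ℝ}
    (hp : 0 < p) (hD0 : 0 < D) (hκ : 0 < κ) (hρ : 0 < ρ) (hθ : 0 < θ)
    (hpers : ∀ (i k : Fin (K + 1)) (j : J), i ≤ k → p * ν k j ≤ ν i j)
    (hD : ∀ (i k : Fin (K + 1)), i ≤ k → ∀ r : Fin K → J,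
      D * ∏ j, ν (k.succAbove j) (r j) ≤ ∏ j, ν (i.succAbove j) (r j)) (hQ0 : ∀ z y, 0 ≤ Q z y)
    (hT : ∀ (z : Fin (K + 1) → J) (l : Fin K), z ∘ Equiv.swap l.castSucc l.succ ≠ z →
      κ * min (tensorFun ν z) (tensorFun ν (z ∘ Equiv.swap l.castSucc l.succ))
        ≤ tensorFun ν z * Q z (z ∘ Equiv.swap l.castSucc l.succ))
    {Q₀ : Matrix J J ℝ} (hρvar : ∀ h : J → ℝ, ρ * lawVariance (ν 0) h ≤ dirichletForm (ν 0) Q₀ h)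
    (hR : ∀ (z : Fin (K + 1) → J) (v : J), v ≠ z 0 →
      θ * (tensorFun ν z * Q₀ (z 0) v) ≤ tensorFun ν z * Q z (update z 0 v))
    (f : (Fin (K + 1) → J) → ℝ) {C : ℝ} (hC0 : 0 ≤ C) (hC1 : C * (6 * K * (K + 1)) ≤ p * D * κ)
    (hC2 : C * (6 * (K + 1)) ≤ p * D * ρ * θ) :
    C * lawVariance (tensorFun ν) f ≤ dirichletForm (tensorFun ν) Q f := by
  have hW0 : ∀ z, 0 ≤ tensorFun ν z := fun z => prod_nonneg fun i _ => hν0 _ _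
  -- the kept quantities
  set T : ℝ := ∑ l : Fin K, ∑ w : Fin (K + 1) → J, tensorFun ν w * Q w (w ∘ Equiv.swap l.castSucc l.succ)
    * (f w - f (w ∘ Equiv.swap l.castSucc l.succ)) ^ 2 with hTdef
  set R : ℝ := (1 / 2) * ∑ z : Fin (K + 1) → J, ∑ v,
    tensorFun ν z * Q z (update z 0 v) * (f z - f (update z 0 v)) ^ 2 with hRdef
  set A : Fin (K + 1) → ℝ := fun k => ∑ z : Fin (K + 1) → J,
    tensorFun ν z * (f z - f (Fin.insertNth 0 (z k) (Fin.removeNth k z))) ^ 2 with hAdef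
  set Bs : Fin (K + 1) → ℝ := fun k => ∑ z : Fin (K + 1) → J, ∑ v, tensorFun ν z * ν k v
    * (f (Fin.insertNth 0 (z k) (Fin.removeNth k z))
        - f (update (Fin.insertNth 0 (z k) (Fin.removeNth k z) : Fin (K + 1) → J) 0 v)) ^ 2 with hBsdef
  have hTle : (1 / 2) * T ≤ dirichletForm (tensorFun ν) Q f :=
    half_sum_transposition_le_dirichletForm hW0 hQ0 f
  have hRle : R ≤ dirichletForm (tensorFun ν) Q f := half_sum_relabel_le_dirichletForm hW0 hQ0 f
  have hT0 : 0 ≤ T := sum_nonneg fun l _ => sum_nonneg fun w _ =>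
    mul_nonneg (mul_nonneg (hW0 w) (hQ0 _ _)) (sq_nonneg _)
  have hR0 : 0 ≤ R := mul_nonneg (by norm_num) (sum_nonneg fun z _ => sum_nonneg fun v _ =>
    mul_nonneg (mul_nonneg (hW0 z) (hQ0 _ _)) (sq_nonneg _))
  have hA : ∀ k : Fin (K + 1), A k ≤ (k : ℝ) / (p * D * κ) * T := fun k =>
    conveyor_arm_le hν0 hp hD0 hκ hpers hD hQ0 hT f k
  have hB : ∀ k : Fin (K + 1), Bs k ≤ 2 / (p * D * ρ * θ) * R := fun k =>
    conveyor_source_le hν0 hν1 hp hD0 hρ hθ hpers hD hρvar hR f k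
  -- the third leg of the split is again the arm term
  have h3 : ∀ k : Fin (K + 1), ∑ z : Fin (K + 1) → J, ∑ v, tensorFun ν z * ν k v
      * (f (update (Fin.insertNth 0 (z k) (Fin.removeNth k z) : Fin (K + 1) → J) 0 v)
          - f (update z k v)) ^ 2 = A k := by
    intro k
    simp only [hAdef]
    conv_lhs => rw [sum_state_eq_sum_insertNth k]
    conv_rhs => rw [sum_state_eq_sum_insertNth k]
    simp only [Fin.insertNth_apply_same, Fin.removeNth_insertNth, Fin.update_insertNth, tensorFun_insertNth]
    calc ∑ a : J, ∑ r : Fin K → J, ∑ v, ν k a * (∏ j, ν (k.succAbove j) (r j)) * ν k v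
          * (f (Fin.insertNth 0 v r) - f (Fin.insertNth k v r)) ^ 2
        = (∑ a : J, ν k a) * ∑ r : Fin K → J, ∑ v, (∏ j, ν (k.succAbove j) (r j)) * ν k v
          * (f (Fin.insertNth 0 v r) - f (Fin.insertNth k v r)) ^ 2 := by
          rw [sum_mul]
          refine sum_congr rfl fun a _ => ?_
          rw [mul_sum]
          refine sum_congr rfl fun r _ => ?_
          rw [mul_sum]
          exact sum_congr rfl fun v _ => by ring
      _ = ∑ v : J, ∑ r : Fin K → J, ν k v * (∏ j, ν (k.succAbove j) (r j))
          * (f (Fin.insertNth k v r) - f (Fin.insertNth 0 v r)) ^ 2 := by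
          rw [hν1 k, one_mul, sum_comm]
          exact sum_congr rfl fun v _ => sum_congr rfl fun r _ => by ring
  -- the first leg, summed over the fresh label
  have hfirst : ∀ k : Fin (K + 1), ∑ z : Fin (K + 1) → J, ∑ v, tensorFun ν z * ν k v
      * (f z - f (Fin.insertNth 0 (z k) (Fin.removeNth k z))) ^ 2 = A k := by
    intro k
    simp only [hAdef]
    refine sum_congr rfl fun z _ => ?_
    rw [show ∑ v, tensorFun ν z * ν k v * (f z - f (Fin.insertNth 0 (z k) (Fin.removeNth k z))) ^ 2
      = (∑ v, ν k v) * (tensorFun ν z * (f z - f (Fin.insertNth 0 (z k) (Fin.removeNth k z))) ^ 2) by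
        rw [sum_mul]; exact sum_congr rfl fun v _ => by ring, hν1 k, one_mul]
  -- the three-leg split of the one-coordinate variances
  have hsplit : ∀ k : Fin (K + 1), (1 / 2) * ∑ z : Fin (K + 1) → J, ∑ v,
      tensorFun ν z * ν k v * (f z - f (update z k v)) ^ 2 ≤ 3 * A k + 3 / 2 * Bs k := by
    intro k
    have hpt : ∀ (z : Fin (K + 1) → J) (v : J), tensorFun ν z * ν k v * (f z - f (update z k v)) ^ 2
        ≤ 3 * (tensorFun ν z * ν k v * (f z - f (Fin.insertNth 0 (z k) (Fin.removeNth k z))) ^ 2)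
          + 3 * (tensorFun ν z * ν k v * (f (Fin.insertNth 0 (z k) (Fin.removeNth k z))
              - f (update (Fin.insertNth 0 (z k) (Fin.removeNth k z) : Fin (K + 1) → J) 0 v)) ^ 2)
          + 3 * (tensorFun ν z * ν k v
              * (f (update (Fin.insertNth 0 (z k) (Fin.removeNth k z) : Fin (K + 1) → J) 0 v)
                - f (update z k v)) ^ 2) := by
      intro z v
      have hw : 0 ≤ tensorFun ν z * ν k v := mul_nonneg (hW0 z) (hν0 _ _)
      have h := Literature.NumberTheory.Sieve.MatomakiRadziwillL14.sq_add_three_le (f z - f (Fin.insertNth 0 (z k) (Fin.removeNth k z)))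
        (f (Fin.insertNth 0 (z k) (Fin.removeNth k z))
          - f (update (Fin.insertNth 0 (z k) (Fin.removeNth k z) : Fin (K + 1) → J) 0 v))
        (f (update (Fin.insertNth 0 (z k) (Fin.removeNth k z) : Fin (K + 1) → J) 0 v) - f (update z k v))
      have e : f z - f (update z k v) = (f z - f (Fin.insertNth 0 (z k) (Fin.removeNth k z)))
          + (f (Fin.insertNth 0 (z k) (Fin.removeNth k z))
            - f (update (Fin.insertNth 0 (z k) (Fin.removeNth k z) : Fin (K + 1) → J) 0 v))
          + (f (update (Fin.insertNth 0 (z k) (Fin.removeNth k z) : Fin (K + 1) → J) 0 v)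
            - f (update z k v)) := by ring
      rw [e]
      have h' := mul_le_mul_of_nonneg_left h hw
      linarith [h']
    calc (1 / 2) * ∑ z : Fin (K + 1) → J, ∑ v, tensorFun ν z * ν k v * (f z - f (update z k v)) ^ 2
        ≤ (1 / 2) * ∑ z : Fin (K + 1) → J, ∑ v,
            (3 * (tensorFun ν z * ν k v * (f z - f (Fin.insertNth 0 (z k) (Fin.removeNth k z))) ^ 2)
            + 3 * (tensorFun ν z * ν k v * (f (Fin.insertNth 0 (z k) (Fin.removeNth k z))
                - f (update (Fin.insertNth 0 (z k) (Fin.removeNth k z) : Fin (K + 1) → J) 0 v)) ^ 2)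
            + 3 * (tensorFun ν z * ν k v
                * (f (update (Fin.insertNth 0 (z k) (Fin.removeNth k z) : Fin (K + 1) → J) 0 v)
                  - f (update z k v)) ^ 2)) :=
          mul_le_mul_of_nonneg_left (sum_le_sum fun z _ => sum_le_sum fun v _ => hpt z v) (by norm_num)
      _ = (1 / 2) * (3 * A k + 3 * Bs k + 3 * A k) := by
          congr 1
          simp only [sum_add_distrib, ← mul_sum]
          rw [hfirst k, h3 k]
      _ = 3 * A k + 3 / 2 * Bs k := by ring
  -- summing over the levels
  have hK : ∑ k : Fin (K + 1), (k : ℝ) = K * (K + 1) / 2 := sum_fin_level_cast K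
  have hpqκ : 0 < p * D * κ := by positivity
  have hall : 0 < p * D * ρ * θ := by positivity
  have hVar : lawVariance (tensorFun ν) f
      ≤ 3 * (K * (K + 1) / 2) / (p * D * κ) * T + 3 * (K + 1) / (p * D * ρ * θ) * R := by
    calc lawVariance (tensorFun ν) f
        ≤ ∑ k : Fin (K + 1), (1 / 2) * ∑ z : Fin (K + 1) → J, ∑ v,
            tensorFun ν z * ν k v * (f z - f (update z k v)) ^ 2 := efronStein_tensorFun hν0 hν1 f
      _ ≤ ∑ k : Fin (K + 1), (3 * ((k : ℝ) / (p * D * κ) * T) + 3 / 2 * (2 / (p * D * ρ * θ) * R)) := by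
          refine sum_le_sum fun k _ => le_trans (hsplit k) ?_
          have := hA k
          have := hB k
          linarith
      _ = 3 * (K * (K + 1) / 2) / (p * D * κ) * T + 3 * (K + 1) / (p * D * ρ * θ) * R := by
          rw [sum_add_distrib, sum_const, card_univ, Fintype.card_fin]
          have e : ∑ k : Fin (K + 1), 3 * ((k : ℝ) / (p * D * κ) * T)
              = 3 * T / (p * D * κ) * ∑ k : Fin (K + 1), (k : ℝ) := by
            rw [mul_sum]
            exact sum_congr rfl fun k _ => by field_simp
          rw [e, hK, nsmul_eq_mul]
          push_cast
          field_simp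
  -- the two budget constraints
  have k1 : C * (3 * (K * (K + 1) / 2) / (p * D * κ) * T) ≤ T / 4 := by
    have e1 : C * (3 * (K * (K + 1) / 2) / (p * D * κ) * T)
        = (C * (6 * K * (K + 1))) / (p * D * κ) * (T / 4) := by
      field_simp
      ring
    rw [e1]
    have : (C * (6 * K * (K + 1))) / (p * D * κ) ≤ 1 := by
      rw [div_le_one hpqκ]; exact hC1
    nlinarith
  have k2 : C * (3 * (K + 1) / (p * D * ρ * θ) * R) ≤ R / 2 := by
    have e2 : C * (3 * (K + 1) / (p * D * ρ * θ) * R)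
        = (C * (6 * (K + 1))) / (p * D * ρ * θ) * (R / 2) := by
      field_simp
      ring
    rw [e2]
    have : (C * (6 * (K + 1))) / (p * D * ρ * θ) ≤ 1 := by
      rw [div_le_one hall]; exact hC2
    nlinarith
  calc C * lawVariance (tensorFun ν) f
      ≤ C * (3 * (K * (K + 1) / 2) / (p * D * κ) * T + 3 * (K + 1) / (p * D * ρ * θ) * R) :=
        mul_le_mul_of_nonneg_left hVar hC0
    _ = C * (3 * (K * (K + 1) / 2) / (p * D * κ) * T) + C * (3 * (K + 1) / (p * D * ρ * θ) * R) := by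
        ring
    _ ≤ T / 4 + R / 2 := add_le_add k1 k2
    _ ≤ dirichletForm (tensorFun ν) Q f := by linarith [hTle, hRle]


/-- **THE CONVEYOR POINCARÉ INEQUALITY UNDER ONE-LEVEL COOLING** (`D = q^K`): with `q·ν_l(j) ≤ ν_{l+1}(j)`
(`0 < q ≤ 1`) in place of the displacement factor, `C·Var_{ν⊗}(f) ≤ 𝓔_{ν⊗}(Q; f)` for every `C ≥ 0` with
`C·6K(K+1) ≤ p q^K κ` and `C·6(K+1) ≤ p q^K ρθ`. [ours] -/
theorem conveyor_poincare_of_cooling (hν0 : ∀ k j, 0 ≤ ν k j) (hν1 : ∀ k, ∑ j, ν k j = 1) {p q κ ρ θ : ℝ}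
    (hp : 0 < p) (hq0 : 0 < q) (hq1 : q ≤ 1) (hκ : 0 < κ) (hρ : 0 < ρ) (hθ : 0 < θ)
    (hpers : ∀ (i k : Fin (K + 1)) (j : J), i ≤ k → p * ν k j ≤ ν i j)
    (hq : ∀ (l : Fin K) (j : J), q * ν l.castSucc j ≤ ν l.succ j) (hQ0 : ∀ z y, 0 ≤ Q z y)
    (hT : ∀ (z : Fin (K + 1) → J) (l : Fin K), z ∘ Equiv.swap l.castSucc l.succ ≠ z →
      κ * min (tensorFun ν z) (tensorFun ν (z ∘ Equiv.swap l.castSucc l.succ))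
        ≤ tensorFun ν z * Q z (z ∘ Equiv.swap l.castSucc l.succ))
    {Q₀ : Matrix J J ℝ} (hρvar : ∀ h : J → ℝ, ρ * lawVariance (ν 0) h ≤ dirichletForm (ν 0) Q₀ h)
    (hR : ∀ (z : Fin (K + 1) → J) (v : J), v ≠ z 0 →
      θ * (tensorFun ν z * Q₀ (z 0) v) ≤ tensorFun ν z * Q z (update z 0 v))
    (f : (Fin (K + 1) → J) → ℝ) {C : ℝ} (hC0 : 0 ≤ C) (hC1 : C * (6 * K * (K + 1)) ≤ p * q ^ K * κ)
    (hC2 : C * (6 * (K + 1)) ≤ p * q ^ K * ρ * θ) :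
    C * lawVariance (tensorFun ν) f ≤ dirichletForm (tensorFun ν) Q f :=
  conveyor_poincare hν0 hν1 hp (pow_pos hq0 K) hκ hρ hθ hpers (displacement_of_cooling hν0 hq0.le hq1 hq) hQ0 hT hρvar
    hR f hC0 hC1 hC2

end Conveyor

end Summit.Ventures.LatticeQCDFlow.Scaling
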